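import Mathlib
import Literature.MathematicalPhysics.QuantumLattice.WilsonDiracAP
import Summits.QuantumFields.QCD.Theorems.QuarksAsStableActionCriticalLineDiamagnetismStubGaugeCoercive
import Summits.QuantumFields.QCD.Theorems.QuarksAsStableActionCriticalLineDiamagnetismStubWardKernel
import Summits.QuantumFields.QCD.Theorems.QuarksAsStableActionCriticalLineDiamagnetismStubBlockHessianFormula
import Summits.QuantumFields.QCD.Theorems.QuarksAsStableActionCriticalLineDiamagnetismStubBlockReductionAux

/-!
# Reduction of the block margin to a per-momentum quadratic-form inequality
(helper for crux stmt-QuantumFields-9734, line `Sketch`, stub `stub_blockReduction`)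

What.  On the `2⁴` block `(ℤ/2)⁴` (colour `Fin 3`, spin `Fin 4`) with constant central link phases
`u_μ = e^{iθ_μ}·1`, `θ ∈ (0,π)⁴`, free `r = 1`, `m = 0` Wilson–Dirac operator `B⁰` and hopping
perturbation `Δ(Y)`, the one-loop block Hessian `Q(Y) = ½ Re tr (B⁰⁻¹ΔY B⁰⁻¹ΔY) − ½ Re tr (B⁰⁻¹Δ(Y⋆Y))`
dominates `γ` times the cell Wilson form `𝒦(Y) = Σ_{x,i<j} ‖Y(x,i) + Y(x+î,j) − Y(x+ĵ,i) − Y(x,j)‖²_F`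
on tiling-odd anti-Hermitian link fields `Y`, as soon as every momentum block `H(s)` of the
block-Hessian formula (`…StubBlockHessianFormula`) satisfies the quadratic-form inequality
`64 γ n_s |y|² ≤ yᵀ H(s) y` on real `4`-vectors `y` supported on the active set `{μ : s_μ = 1}` (size
`n_s`) and summing to zero (`stub_blockReduction`).  This is the common reduction behind the
pointwise stubs `stub_blockMargin0..3b`.

How.
* Coulomb gauge: with the anti-Hermitian generator `λ(x) = Σ_s (χ_s(x)/(32 n_s)) Σ_μ Ŷ_μ(s)` of
  `…StubGaugeCoercive`, the gauged field `Y' = Y − dλ` has Walsh components `Ŷ'_μ(s)` supported on the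
  active directions and summing to zero, and `𝒦(Y) = ¼ Σ_s n_s Σ_μ ‖Ŷ'_μ(s)‖²_F` (real scalar core
  `stub_blockReductionAux`, applied to the real and imaginary parts of every colour entry).
* Ward: `Q(Y') = Q(Y)` — the polar form of `Q` kills gauge modes (`stub_wardKernel`, additivity of `Δ`).
* Formula: `Q(Y') = (1/256) Σ_s Σ_{μν} H(s)_{μν} Re tr (Ŷ'_μ(s)ᴴ Ŷ'_ν(s))`
  (`BlockHessianFormula.blockHessian_eq`; its hypothesis `h(θ + πs') > 0` holds as `sin² θ₀ > 0`).
* `Re tr (Mᴴ N) = Σ_{ab} (Re M_{ab} Re N_{ab} + Im M_{ab} Im N_{ab})`, and the hypothesis is applied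
  to the `18` real vectors `Re Ŷ'(s)_{ab}`, `Im Ŷ'(s)_{ab}` per class `s`.

Sources: Montvay–Münster, *Quantum Fields on a Lattice* §4.2 (Wilson fermions, hopping expansion,
gauge invariance of the fermion determinant); folklore (Walsh analysis on the hypercube).
Pure theorem file (no `def`s).
-/

noncomputable section

open scoped BigOperators Classical Matrix ComplexConjugate
open Finset
open Literature.MathematicalPhysics.QuantumLattice Literature.MathematicalPhysics.QuantumFieldTheory
  Literature.Probability.LatticeModels

namespace Summit.QuantumFields.QCD.Cruxes.CriticalLineDiamagnetism.ChessboardCellGain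

open Complex (I)

namespace BlockReduction

/-! ### Small pieces of linear algebra -/

/-- `Re tr (Mᴴ N) = Σ_{ab} (Re M_{ab} Re N_{ab} + Im M_{ab} Im N_{ab})`. -/
theorem re_trace_conjTranspose_mul (M N : Matrix (Fin 3) (Fin 3) ℂ) :
    ((Mᴴ * N).trace).re = ∑ a, ∑ b, ((M a b).re * (N a b).re + (M a b).im * (N a b).im) := by
  simp only [Matrix.trace, Matrix.diag, Matrix.mul_apply, Matrix.conjTranspose_apply,
    Complex.star_def, Complex.re_sum, Complex.mul_re, Complex.conj_re, Complex.conj_im]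
  rw [Finset.sum_comm]
  refine Finset.sum_congr rfl fun a _ => Finset.sum_congr rfl fun b _ => ?_
  ring

/-- Moving the colour indices to the front of a momentum-block sum. -/
theorem sum_swap (F : Fin 4 → Fin 4 → Fin 3 → Fin 3 → ℝ) :
    ∑ μ, ∑ ν, ∑ a, ∑ b, F μ ν a b = ∑ a, ∑ b, ∑ μ, ∑ ν, F μ ν a b := by
  calc _ = ∑ μ, ∑ a, ∑ b, ∑ ν, F μ ν a b := Finset.sum_congr rfl fun μ _ => by
          rw [Finset.sum_comm]
          exact Finset.sum_congr rfl fun a _ => Finset.sum_comm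
    _ = _ := by
          rw [Finset.sum_comm]
          exact Finset.sum_congr rfl fun a _ => Finset.sum_comm

/-! ### The reduction (abstract form) -/

section Main

variable (m : ℝ) (θ : Fin 4 → ℝ) (u : Fin 4 → Matrix.unitaryGroup (Fin 3) ℂ)
  (B0 : Matrix (TorusSite 4 2 × Fin 3 × Fin 4) (TorusSite 4 2 × Fin 3 × Fin 4) ℂ)
  (Dl : (Edge 4 2 → Matrix (Fin 3) (Fin 3) ℂ) →
    Matrix (TorusSite 4 2 × Fin 3 × Fin 4) (TorusSite 4 2 × Fin 3 × Fin 4) ℂ)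
  (Mw h : (Fin 4 → ℝ) → ℝ) (S : (Fin 4 → ℝ) → Matrix (Fin 4) (Fin 4) ℂ)
  (V : (Fin 4 → ℝ) → (Fin 4 → ℝ) → Fin 4 → Matrix (Fin 4) (Fin 4) ℂ)
  (mom qv : (Fin 4 → ZMod 2) → Fin 4 → ℝ)
  (H : (Fin 4 → ZMod 2) → Fin 4 → Fin 4 → ℝ)
  (chi : (Fin 4 → ZMod 2) → TorusSite 4 2 → ℝ)
  (Yh : (Edge 4 2 → Matrix (Fin 3) (Fin 3) ℂ) → (Fin 4 → ZMod 2) → Fin 4 → Matrix (Fin 3) (Fin 3) ℂ)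

/-- **The reduction** (abstract form of `stub_blockReduction`, any mass `m`): if every momentum block
`H(s)` satisfies `64 γ n_s |y|² ≤ yᵀ H(s) y` on real vectors supported on `{μ : s_μ = 1}` and summing to
zero, and the polarised Ward identity holds, then `γ 𝒦(Y) ≤ Q(Y)` for every tiling-odd anti-Hermitian
block link field `Y`. -/
theorem main
    (hθ : ∀ μ, 0 < θ μ ∧ θ μ < Real.pi)
    (hu : ∀ μ, (u μ : Matrix (Fin 3) (Fin 3) ℂ) = Complex.exp (↑(θ μ) * I) • (1 : Matrix (Fin 3) (Fin 3) ℂ))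
    (hB0 : B0 = wilsonDirac (unitaryFundamentalRep (Fin 3) ℂ) (fun e : Edge 4 2 => u e.2) m 1)
    (hDl : ∀ E, Dl E = Matrix.of fun p q : TorusSite 4 2 × Fin 3 × Fin 4 => -(1 / 2 : ℂ) * ∑ μ : Fin 4,
      ((if q.1 = Site.shift p.1 μ then ((1 : Matrix (Fin 4) (Fin 4) ℂ) - euclideanGamma μ) p.2.2 q.2.2 *
          ((u μ : Matrix (Fin 3) (Fin 3) ℂ) * E (p.1, μ)) p.2.1 q.2.1 else 0) +
        (if p.1 = Site.shift q.1 μ then ((1 : Matrix (Fin 4) (Fin 4) ℂ) + euclideanGamma μ) p.2.2 q.2.2 *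
          ((u μ : Matrix (Fin 3) (Fin 3) ℂ) * E (q.1, μ))ᴴ p.2.1 q.2.1 else 0)))
    (hMw : ∀ P, Mw P = m + ∑ κ, (1 - Real.cos (P κ)))
    (hh : ∀ P, h P = Mw P ^ 2 + ∑ κ, Real.sin (P κ) ^ 2)
    (hS : ∀ P, S P = ((h P)⁻¹ : ℂ) • (((Mw P : ℝ) : ℂ) • (1 : Matrix (Fin 4) (Fin 4) ℂ) -
      I • ∑ κ, ((Real.sin (P κ) : ℝ) : ℂ) • euclideanGamma κ))
    (hV : ∀ P q μ, V P q μ = (-(1 / 2 : ℂ) * (Complex.exp (↑(P μ) * I) * I)) •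
        ((1 : Matrix (Fin 4) (Fin 4) ℂ) - euclideanGamma μ) +
      (-(1 / 2 : ℂ) * (Complex.exp (-(↑(P μ + q μ) * I)) * (-I))) • ((1 : Matrix (Fin 4) (Fin 4) ℂ) + euclideanGamma μ))
    (hmom : ∀ s κ, mom s κ = θ κ + Real.pi * ((s κ).val : ℝ))
    (hqv : ∀ s κ, qv s κ = Real.pi * ((s κ).val : ℝ))
    (hH : ∀ s μ ν, H s μ ν = (if μ = ν then (1 / 2 : ℝ) * ∑ s' : Fin 4 → ZMod 2,
        4 * (Real.sin (mom s' μ) ^ 2 - Mw (mom s') * Real.cos (mom s' μ)) / h (mom s') else 0) +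
      (1 / 2 : ℝ) * (∑ s' : Fin 4 → ZMod 2, (S (mom s') * V (mom s' + qv s) (qv s) ν * S (mom s' + qv s) *
        V (mom s') (qv s) μ).trace).re)
    (hchi : ∀ s x, chi s x = (-1 : ℝ) ^ (∑ κ, (s κ).val * (x κ).val))
    (hYh : ∀ E s μ, Yh E s μ = ∑ x, ((chi s x : ℝ) : ℂ) • E (x, μ))
    (hward : ∀ (Z : Edge 4 2 → Matrix (Fin 3) (Fin 3) ℂ) (lam : TorusSite 4 2 → Matrix (Fin 3) (Fin 3) ℂ),
      (∀ e, (Z e)ᴴ = -Z e) → (∀ x, (lam x)ᴴ = -lam x) →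
        (B0⁻¹ * Dl Z * (B0⁻¹ * Dl (fun e => lam e.1 - lam (Site.shift e.1 e.2)))).trace.re =
          (B0⁻¹ * Dl (fun e => Z e * (lam e.1 - lam (Site.shift e.1 e.2)) +
            (lam e.1 - lam (Site.shift e.1 e.2)) * Z e)).trace.re / 2)
    (γ : ℝ)
    (hblock : ∀ (s : Fin 4 → ZMod 2) (y : Fin 4 → ℝ), (∀ μ, s μ = 0 → y μ = 0) → ∑ μ, y μ = 0 →
      64 * γ * (((Finset.univ.filter (fun μ : Fin 4 => s μ = 1)).card : ℝ) * ∑ μ, y μ ^ 2) ≤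
        ∑ μ, ∑ ν, H s μ ν * (y μ * y ν))
    (Y : Edge 4 2 → Matrix (Fin 3) (Fin 3) ℂ) (hY : ∀ e, (Y e)ᴴ = -Y e)
    (hodd : ∀ (x : TorusSite 4 2) (μ : Fin 4), Y (Site.shift x μ, μ) = -Y (x, μ)) :
    γ * (∑ p : Plaquette 4 2, ∑ a, ∑ b, ‖(Y (p.1, p.2.1.1) + Y (Site.shift p.1 p.2.1.1, p.2.1.2) -
        Y (Site.shift p.1 p.2.1.2, p.2.1.1) - Y (p.1, p.2.1.2)) a b‖ ^ 2) ≤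
      (B0⁻¹ * Dl Y * (B0⁻¹ * Dl Y)).trace.re / 2 - (B0⁻¹ * Dl (fun e => Y e * Y e)).trace.re / 2 := by
  -- (0) the free symbol denominators are positive: `h(θ + πs') ≥ sin² θ₀ > 0`
  have hpos : ∀ s', 0 < h (mom s') := by
    intro s'
    have h1 : Real.sin (mom s' 0) ^ 2 = Real.sin (θ 0) ^ 2 := by
      rw [hmom, mul_comm Real.pi, Real.sin_add_nat_mul_pi, mul_pow]
      rcases neg_one_pow_eq_or ℝ (s' 0).val with h' | h' <;> rw [h'] <;> norm_num
    have h2 : Real.sin (mom s' 0) ^ 2 ≤ ∑ κ, Real.sin (mom s' κ) ^ 2 :=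
      Finset.single_le_sum (fun κ _ => sq_nonneg (Real.sin (mom s' κ))) (Finset.mem_univ 0)
    have h3 : 0 < Real.sin (θ 0) ^ 2 := pow_pos (Real.sin_pos_of_pos_of_lt_pi (hθ 0).1 (hθ 0).2) 2
    rw [hh]
    nlinarith [sq_nonneg (Mw (mom s'))]
  -- (1) the Coulomb gauge generator and the gauged field
  obtain ⟨lam, hlam⟩ : ∃ lam : TorusSite 4 2 → Matrix (Fin 3) (Fin 3) ℂ, ∀ x, lam x =
      ∑ s, ((chi s x / (32 * ((Finset.univ.filter (fun μ : Fin 4 => s μ = 1)).card : ℝ)) : ℝ) : ℂ) •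
        ∑ μ : Fin 4, ∑ y, ((chi s y : ℝ) : ℂ) • Y (y, μ) := ⟨_, fun _ => rfl⟩
  have hlam' : ∀ x, (lam x)ᴴ = -lam x := fun x => by
    simp only [hlam, Matrix.conjTranspose_sum, Matrix.conjTranspose_smul, Complex.star_def,
      Complex.conj_ofReal, hY, smul_neg, Finset.sum_neg_distrib]
  obtain ⟨D, hD⟩ : ∃ D : Edge 4 2 → Matrix (Fin 3) (Fin 3) ℂ,
      ∀ e, D e = lam e.1 - lam (Site.shift e.1 e.2) := ⟨_, fun _ => rfl⟩
  have hDf : (fun e : Edge 4 2 => lam e.1 - lam (Site.shift e.1 e.2)) = D :=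
    funext fun e => (hD e).symm
  have hDh : ∀ e, (D e)ᴴ = -D e := fun e => by
    rw [hD, Matrix.conjTranspose_sub, hlam', hlam']
    abel
  obtain ⟨Y', hY'⟩ : ∃ Y' : Edge 4 2 → Matrix (Fin 3) (Fin 3) ℂ, ∀ e, Y' e = Y e - D e :=
    ⟨_, fun _ => rfl⟩
  have hY'h : ∀ e, (Y' e)ᴴ = -Y' e := fun e => by
    rw [hY', Matrix.conjTranspose_sub, hY, hDh]
    abel
  -- (2) Ward: `Q(Y') = Q(Y)`
  have hadd : ∀ E₁ E₂ : Edge 4 2 → Matrix (Fin 3) (Fin 3) ℂ, Dl (E₁ + E₂) = Dl E₁ + Dl E₂ := by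
    intro E₁ E₂
    rw [hDl, hDl, hDl]
    ext p q
    simp only [Matrix.of_apply, Matrix.add_apply, Pi.add_apply, Matrix.mul_add,
      Matrix.conjTranspose_add]
    rw [← mul_add, ← Finset.sum_add_distrib]
    congr 1
    refine Finset.sum_congr rfl fun μ _ => ?_
    split_ifs <;> ring
  have hsub : ∀ E₁ E₂ : Edge 4 2 → Matrix (Fin 3) (Fin 3) ℂ, Dl (E₁ - E₂) = Dl E₁ - Dl E₂ :=
    fun E₁ E₂ => eq_sub_of_add_eq (by rw [← hadd, sub_add_cancel])
  have w1 : (B0⁻¹ * Dl Y * (B0⁻¹ * Dl D)).trace.re =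
      (B0⁻¹ * Dl (fun e => Y e * D e + D e * Y e)).trace.re / 2 := by
    have h1 := hward Y lam hY hlam'
    rw [hDf] at h1
    rw [h1]
    simp only [hD]
  have w2 : (B0⁻¹ * Dl D * (B0⁻¹ * Dl D)).trace.re = (B0⁻¹ * Dl (fun e => D e * D e)).trace.re := by
    have h1 := hward D lam hDh hlam'
    rw [hDf] at h1
    have h2 : (fun e : Edge 4 2 => D e * (lam e.1 - lam (Site.shift e.1 e.2)) +
        (lam e.1 - lam (Site.shift e.1 e.2)) * D e) = (fun e => D e * D e) + fun e => D e * D e := by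
      funext e
      simp only [← hD, Pi.add_apply]
    rw [h1, h2, hadd, Matrix.mul_add, Matrix.trace_add, Complex.add_re]
    ring
  have hQ : (B0⁻¹ * Dl Y' * (B0⁻¹ * Dl Y')).trace.re / 2 - (B0⁻¹ * Dl (fun e => Y' e * Y' e)).trace.re / 2 =
      (B0⁻¹ * Dl Y * (B0⁻¹ * Dl Y)).trace.re / 2 - (B0⁻¹ * Dl (fun e => Y e * Y e)).trace.re / 2 := by
    have hY'f : Y' = Y - D := funext fun e => by rw [hY', Pi.sub_apply]
    have hsq : (fun e => Y' e * Y' e) =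
        (fun e => Y e * Y e) - (fun e => Y e * D e + D e * Y e) + fun e => D e * D e := by
      funext e
      simp only [hY', Pi.add_apply, Pi.sub_apply, mul_sub, sub_mul]
      abel
    have hcomm : (B0⁻¹ * Dl D * (B0⁻¹ * Dl Y)).trace.re = (B0⁻¹ * Dl Y * (B0⁻¹ * Dl D)).trace.re := by
      rw [Matrix.trace_mul_comm]
    rw [hsq, hY'f, hadd, hsub, hsub]
    simp only [Matrix.mul_sub, Matrix.sub_mul, Matrix.mul_add, Matrix.trace_sub, Matrix.trace_add,
      Complex.sub_re, Complex.add_re]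
    linarith [hcomm, w1, w2]
  -- (3) the block-Hessian formula for the gauged field
  rw [← hQ, BlockHessianFormula.blockHessian_eq m θ u B0 Dl Mw h S V mom qv chi Yh Y' H hu hB0 hDl
    hMw hh hS hV hmom hqv hH hchi hYh hpos hY'h]
  -- (4) the Walsh components of the gauged field, entry by entry
  obtain ⟨R, hR⟩ : ∃ R : (Fin 4 → ZMod 2) → Fin 4 → Fin 3 → Fin 3 → ℝ,
      ∀ s μ a b, R s μ a b = (Yh Y' s μ a b).re := ⟨_, fun _ _ _ _ => rfl⟩
  obtain ⟨J, hJ⟩ : ∃ J : (Fin 4 → ZMod 2) → Fin 4 → Fin 3 → Fin 3 → ℝ,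
      ∀ s μ a b, J s μ a b = (Yh Y' s μ a b).im := ⟨_, fun _ _ _ _ => rfl⟩
  have auxR : ∀ a b, (∀ s μ, s μ = 0 → R s μ a b = 0) ∧ (∀ s, ∑ μ, R s μ a b = 0) ∧
      ∑ p : Plaquette 4 2, ((Y (p.1, p.2.1.1) + Y (Site.shift p.1 p.2.1.1, p.2.1.2) -
        Y (Site.shift p.1 p.2.1.2, p.2.1.1) - Y (p.1, p.2.1.2)) a b).re ^ 2 =
      (1 / 4 : ℝ) * ∑ s : Fin 4 → ZMod 2, ((Finset.univ.filter (fun μ : Fin 4 => s μ = 1)).card : ℝ) *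
        ∑ μ, R s μ a b ^ 2 := by
    intro a b
    have key := stub_blockReductionAux chi hchi (fun e => (Y e a b).re) (fun x μ => by simp [hodd])
      (fun x => (lam x a b).re) (fun x => by
        simp only [hlam, Matrix.sum_apply, Matrix.smul_apply, smul_eq_mul, Complex.re_sum,
          Complex.re_ofReal_mul])
      (fun s μ => R s μ a b) (fun s μ => by
        simp only [hR, hYh, hY', hD, Matrix.sum_apply, Matrix.smul_apply, Matrix.sub_apply, smul_eq_mul,
          Complex.re_sum, Complex.re_ofReal_mul, Complex.sub_re])
    simpa only [Matrix.sub_apply, Matrix.add_apply, Complex.sub_re, Complex.add_re] using key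
  have auxI : ∀ a b, (∀ s μ, s μ = 0 → J s μ a b = 0) ∧ (∀ s, ∑ μ, J s μ a b = 0) ∧
      ∑ p : Plaquette 4 2, ((Y (p.1, p.2.1.1) + Y (Site.shift p.1 p.2.1.1, p.2.1.2) -
        Y (Site.shift p.1 p.2.1.2, p.2.1.1) - Y (p.1, p.2.1.2)) a b).im ^ 2 =
      (1 / 4 : ℝ) * ∑ s : Fin 4 → ZMod 2, ((Finset.univ.filter (fun μ : Fin 4 => s μ = 1)).card : ℝ) *
        ∑ μ, J s μ a b ^ 2 := by
    intro a b
    have key := stub_blockReductionAux chi hchi (fun e => (Y e a b).im) (fun x μ => by simp [hodd])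
      (fun x => (lam x a b).im) (fun x => by
        simp only [hlam, Matrix.sum_apply, Matrix.smul_apply, smul_eq_mul, Complex.im_sum,
          Complex.im_ofReal_mul])
      (fun s μ => J s μ a b) (fun s μ => by
        simp only [hJ, hYh, hY', hD, Matrix.sum_apply, Matrix.smul_apply, Matrix.sub_apply, smul_eq_mul,
          Complex.im_sum, Complex.im_ofReal_mul, Complex.sub_im])
    simpa only [Matrix.sub_apply, Matrix.add_apply, Complex.sub_im, Complex.add_im] using key
  -- (5) both sides entry by entry
  have hK : (∑ p : Plaquette 4 2, ∑ a, ∑ b, ‖(Y (p.1, p.2.1.1) + Y (Site.shift p.1 p.2.1.1, p.2.1.2) -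
      Y (Site.shift p.1 p.2.1.2, p.2.1.1) - Y (p.1, p.2.1.2)) a b‖ ^ 2) =
      ∑ a, ∑ b, ((1 / 4 : ℝ) * ∑ s : Fin 4 → ZMod 2,
          ((Finset.univ.filter (fun μ : Fin 4 => s μ = 1)).card : ℝ) * ∑ μ, R s μ a b ^ 2 +
        (1 / 4 : ℝ) * ∑ s : Fin 4 → ZMod 2,
          ((Finset.univ.filter (fun μ : Fin 4 => s μ = 1)).card : ℝ) * ∑ μ, J s μ a b ^ 2) := by
    rw [GaugeCoercive.sum_frob_eq_re_im]
    refine Finset.sum_congr rfl fun a _ => Finset.sum_congr rfl fun b _ => ?_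
    rw [(auxR a b).2.2, (auxI a b).2.2]
  have hRJ : ∑ s, ∑ μ, ∑ ν, H s μ ν * ((Yh Y' s μ)ᴴ * Yh Y' s ν).trace.re =
      ∑ s, ∑ a, ∑ b, ∑ μ, ∑ ν, H s μ ν * (R s μ a b * R s ν a b + J s μ a b * J s ν a b) := by
    refine Finset.sum_congr rfl fun s _ => ?_
    simp only [re_trace_conjTranspose_mul, Finset.mul_sum, ← hR, ← hJ]
    exact sum_swap _
  have step : ∀ a b, γ * ((1 / 4 : ℝ) * ∑ s : Fin 4 → ZMod 2,
          ((Finset.univ.filter (fun μ : Fin 4 => s μ = 1)).card : ℝ) * ∑ μ, R s μ a b ^ 2 +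
        (1 / 4 : ℝ) * ∑ s : Fin 4 → ZMod 2,
          ((Finset.univ.filter (fun μ : Fin 4 => s μ = 1)).card : ℝ) * ∑ μ, J s μ a b ^ 2) ≤
      (1 / 256 : ℝ) * ∑ s, ∑ μ, ∑ ν, H s μ ν * (R s μ a b * R s ν a b + J s μ a b * J s ν a b) := by
    intro a b
    have hfin : ∀ s : Fin 4 → ZMod 2,
        64 * γ * (((Finset.univ.filter (fun μ : Fin 4 => s μ = 1)).card : ℝ) * ∑ μ, R s μ a b ^ 2) +
          64 * γ * (((Finset.univ.filter (fun μ : Fin 4 => s μ = 1)).card : ℝ) * ∑ μ, J s μ a b ^ 2) ≤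
        ∑ μ, ∑ ν, H s μ ν * (R s μ a b * R s ν a b + J s μ a b * J s ν a b) := by
      intro s
      have h1 := hblock s (fun μ => R s μ a b) (fun μ hμ => (auxR a b).1 s μ hμ) ((auxR a b).2.1 s)
      have h2 := hblock s (fun μ => J s μ a b) (fun μ hμ => (auxI a b).1 s μ hμ) ((auxI a b).2.1 s)
      simp only [mul_add, Finset.sum_add_distrib]
      exact add_le_add h1 h2
    calc _ = (1 / 256 : ℝ) * ∑ s : Fin 4 → ZMod 2,
          (64 * γ * (((Finset.univ.filter (fun μ : Fin 4 => s μ = 1)).card : ℝ) * ∑ μ, R s μ a b ^ 2) +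
            64 * γ * (((Finset.univ.filter (fun μ : Fin 4 => s μ = 1)).card : ℝ) * ∑ μ, J s μ a b ^ 2)) := by
          rw [Finset.sum_add_distrib, ← Finset.mul_sum, ← Finset.mul_sum]
          ring
      _ ≤ _ := mul_le_mul_of_nonneg_left (Finset.sum_le_sum fun s _ => hfin s) (by norm_num)
  rw [hK, hRJ]
  calc _ = ∑ a, ∑ b, γ * ((1 / 4 : ℝ) * ∑ s : Fin 4 → ZMod 2,
          ((Finset.univ.filter (fun μ : Fin 4 => s μ = 1)).card : ℝ) * ∑ μ, R s μ a b ^ 2 +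
        (1 / 4 : ℝ) * ∑ s : Fin 4 → ZMod 2,
          ((Finset.univ.filter (fun μ : Fin 4 => s μ = 1)).card : ℝ) * ∑ μ, J s μ a b ^ 2) := by
          simp only [Finset.mul_sum]
    _ ≤ ∑ a, ∑ b, (1 / 256 : ℝ) * ∑ s, ∑ μ, ∑ ν,
          H s μ ν * (R s μ a b * R s ν a b + J s μ a b * J s ν a b) :=
          Finset.sum_le_sum fun a _ => Finset.sum_le_sum fun b _ => step a b
    _ = (1 / 256 : ℝ) * ∑ a, ∑ b, ∑ s, ∑ μ, ∑ ν,
          H s μ ν * (R s μ a b * R s ν a b + J s μ a b * J s ν a b) := by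
          simp only [← Finset.mul_sum]
    _ = _ := by
          congr 1
          exact (Finset.sum_congr rfl fun _ _ => Finset.sum_comm).trans Finset.sum_comm

end Main

end BlockReduction

open BlockReduction in
/-- **Stub BR — reduction of the block margin to momentum blocks** (`stub_blockReduction`): on the
`2⁴` block with constant central phases `u_μ = e^{iθ_μ}·1`, `θ ∈ (0,π)⁴`, `m = 0`, if every momentum
block `H(s)` of the block-Hessian formula satisfies `64 γ n_s |y|² ≤ yᵀ H(s) y` for real `4`-vectors
`y` supported on `{μ : s_μ = 1}` with `Σ y = 0`, then `γ 𝒦(Y) ≤ Q(Y)` for every tiling-odd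
anti-Hermitian block link field `Y`.  Proof: `BlockReduction.main` with the Ward identity
`stub_wardKernel` at `m = 0`. -/
theorem stub_blockReduction : ∀ (θ : Fin 4 → ℝ) (u : Fin 4 → Matrix.unitaryGroup (Fin 3) ℂ), (∀ μ, 0 < θ μ ∧ θ μ < Real.pi) → (∀ μ, ((u μ : Matrix.unitaryGroup (Fin 3) ℂ) : Matrix (Fin 3) (Fin 3) ℂ) = Complex.exp (↑(θ μ) * Complex.I) • (1 : Matrix (Fin 3) (Fin 3) ℂ)) → let B0 : Matrix (TorusSite 4 2 × Fin 3 × Fin 4) (TorusSite 4 2 × Fin 3 × Fin 4) ℂ := wilsonDirac (unitaryFundamentalRep (Fin 3) ℂ) (fun e : Edge 4 2 => u e.2) 0 1; let Dl : (Edge 4 2 → Matrix (Fin 3) (Fin 3) ℂ) → Matrix (TorusSite 4 2 × Fin 3 × Fin 4) (TorusSite 4 2 × Fin 3 × Fin 4) ℂ := fun E => Matrix.of fun p q => -(1 / 2 : ℂ) * ∑ μ : Fin 4, ((if q.1 = Site.shift p.1 μ then ((1 : Matrix (Fin 4) (Fin 4) ℂ) - euclideanGamma μ) p.2.2 q.2.2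 * (((u μ : Matrix.unitaryGroup (Fin 3) ℂ) : Matrix (Fin 3) (Fin 3) ℂ) * E (p.1, μ)) p.2.1 q.2.1 else 0) + (if p.1 = Site.shift q.1 μ then ((1 : Matrix (Fin 4) (Fin 4) ℂ) + euclideanGamma μ) p.2.2 q.2.2 * (((u μ : Matrix.unitaryGroup (Fin 3) ℂ) : Matrix (Fin 3) (Fin 3) ℂ) * E (q.1, μ))ᴴ p.2.1 q.2.1 else 0)); let Mw : (Fin 4 → ℝ) → ℝ := fun P => (0 : ℝ) + ∑ κ : Fin 4, (1 - Real.cos (P κ)); let h : (Fin 4 → ℝ) → ℝ := fun P => Mw P ^ 2 + ∑ κ : Fin 4, Real.sin (P κ) ^ 2; let S : (Fin 4 → ℝ) → Matrix (Fin 4) (Fin 4) ℂ := fun P => ((h P)⁻¹ : ℂ) • (((Mw P : ℝ) : ℂ) • (1 : Matrix (Fin 4) (Fin 4) ℂ) - Complex.I • ∑ κ : Fin 4, ((Real.sin (P κ) : ℝ) : ℂ) • euclideanGamma κ); let V : (Fin 4 → ℝ) → (Fin 4 → ℝ) → Fin 4 → Matrix (Fin 4) (Fin 4) ℂ := fun P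 q μ => (-(1 / 2 : ℂ) * (Complex.exp (↑(P μ) * Complex.I) * Complex.I)) • ((1 : Matrix (Fin 4) (Fin 4) ℂ) - euclideanGamma μ) + (-(1 / 2 : ℂ) * (Complex.exp (-(↑(P μ + q μ) * Complex.I)) * (-Complex.I))) • ((1 : Matrix (Fin 4) (Fin 4) ℂ) + euclideanGamma μ); let mom : (Fin 4 → ZMod 2) → (Fin 4 → ℝ) := fun s κ => θ κ + Real.pi * ((s κ).val : ℝ); let qv : (Fin 4 → ZMod 2) → (Fin 4 → ℝ) := fun s κ => Real.pi * ((s κ).val : ℝ); let H : (Fin 4 → ZMod 2) → Fin 4 → Fin 4 → ℝ := fun s μ ν => (if μ = ν then (1 / 2 : ℝ) * ∑ s' : Fin 4 → ZMod 2, 4 * (Real.sin (mom s' μ) ^ 2 - Mw (mom s') * Real.cos (mom s' μ)) / h (mom s') else 0) + (1 / 2 : ℝ) * (∑ s' : Fin 4 → ZMod 2, (S (mom s') * V (mom s' + qv s) (qv s) ν * S (mom s' + qv s) * V (mom s') (qv s) μ).trace).re; ∀ γ : ℝ, (∀ (s : Fin 4 → ZMod 2) (y : Fin 4 → ℝ),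 (∀ μ, s μ = 0 → y μ = 0) → ∑ μ, y μ = 0 → 64 * γ * (((Finset.univ.filter (fun μ : Fin 4 => s μ = 1)).card : ℝ) * ∑ μ, y μ ^ 2) ≤ ∑ μ, ∑ ν, H s μ ν * (y μ * y ν)) → ∀ Y : Edge 4 2 → Matrix (Fin 3) (Fin 3) ℂ, (∀ e, (Y e)ᴴ = -Y e) → (∀ (x : TorusSite 4 2) (μ : Fin 4), Y (Site.shift x μ, μ) = -Y (x, μ)) → γ * (∑ p : Plaquette 4 2, ∑ a, ∑ b, ‖(Y (p.1, p.2.1.1) + Y (Site.shift p.1 p.2.1.1, p.2.1.2) - Y (Site.shift p.1 p.2.1.2, p.2.1.1) - Y (p.1, p.2.1.2)) a b‖ ^ 2) ≤ ((B0⁻¹ * Dl Y * (B0⁻¹ * Dl Y)).trace.re / 2 - (B0⁻¹ * Dl (fun e => Y e * Y e)).trace.re / 2) := by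
  intro θ u hθ hu B0 Dl Mw h S V mom qv H γ hblock Y hY hodd
  -- the polarised Ward identity on this block (taken while the `let`s are transparent)
  have hW : ∀ (Z : Edge 4 2 → Matrix (Fin 3) (Fin 3) ℂ) (lam : TorusSite 4 2 → Matrix (Fin 3) (Fin 3) ℂ),
      (∀ e, (Z e)ᴴ = -Z e) → (∀ x, (lam x)ᴴ = -lam x) →
        (B0⁻¹ * Dl Z * (B0⁻¹ * Dl (fun e => lam e.1 - lam (Site.shift e.1 e.2)))).trace.re =
          (B0⁻¹ * Dl (fun e => Z e * (lam e.1 - lam (Site.shift e.1 e.2)) +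
            (lam e.1 - lam (Site.shift e.1 e.2)) * Z e)).trace.re / 2 :=
    stub_wardKernel 0 θ u hu
  exact main 0 θ u B0 Dl Mw h S V mom qv H (fun s x => (-1 : ℝ) ^ (∑ κ, (s κ).val * (x κ).val))
    (fun E s μ => ∑ x, (((-1 : ℝ) ^ (∑ κ, (s κ).val * (x κ).val) : ℝ) : ℂ) • E (x, μ)) hθ hu rfl
    (fun _ => rfl) (fun _ => rfl) (fun _ => rfl) (fun _ => rfl) (fun _ _ _ => rfl) (fun _ _ => rfl)
    (fun _ _ => rfl) (fun _ _ _ => rfl) (fun _ _ => rfl) (fun _ _ _ => rfl) hW γ hblock Y hY hodd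

end Summit.QuantumFields.QCD.Cruxes.CriticalLineDiamagnetism.ChessboardCellGain

end
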